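import Mathlib
import Literature.Combinatorics.SimpleGraph.LovaszTheta
import Literature.Combinatorics.SimpleGraph.LovaszThetaDual
import Literature.Combinatorics.Optimization.DeKlerkPasechnikLovaszTheta
import HarnessLib

/-!
# `ϑ` of the strong product: Lovász's Theorem 7 `ϑ(G ⊠ H) = ϑ(G) ϑ(H)`, Knuth's direct
(co)product lemmas, and Shannon's `α(C₅ ⊠ C₅) = 5`

The **strong product** `G ⊠ H` of simple graphs (Shannon 1956; Lovász 1979, §I: `G · H`; Knuth
1994, §20 (20.2)–(20.3): `G' ∗ G''`) has vertex set `V × W`, two distinct pairs being adjacent iff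
each coordinate is "adjacent or equal"; Knuth's **direct coproduct** `G ∗̄ H` (§21 (21.1)–(21.2),
the disjunctive product) is `(Gᶜ ⊠ Hᶜ)ᶜ`: two pairs are adjacent iff SOME coordinate is adjacent.

For the tree's Lovász number `lovaszTheta` (the maximisation form over feasible matrices
`B ⪰ 0, Tr B = 1, B|_E = 0`, Lovász 1979 Theorem 4 / Knuth's `ϑ₃`) we prove, on nonempty finite
vertex types,

* `mul_le_lovaszTheta_strongCoprod` — `ϑ(G) ϑ(H) ≤ ϑ(G ∗̄ H)`: the Kronecker product `B ⊗ₖ C`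
  of feasible matrices is feasible even for the coproduct (`isThetaFeasible_kronecker_strongCoprod`;
  `Matrix.PosSemidef.kronecker`, `Matrix.trace_kronecker`) and has value `(𝟙ᵀB𝟙)(𝟙ᵀC𝟙)`
  (`entrySum_kronecker`);
* `lovaszTheta_strongProd_le_mul` — `ϑ(G ⊠ H) ≤ ϑ(G) ϑ(H)`: by the tree's eigenvalue (dual)
  characterisation (`exists_dual_of_lovaszTheta_eq`: a dual-feasible `A` — symmetric, `= 1` off the
  edges — with `ϑ(G) I - A ⪰ 0`) the matrix
  `prodDual A A' ϑ ϑ' = ϑϑ' I - (J ⊗ₖ D + C ⊗ₖ J + C ⊗ₖ D)`, `C = ϑ I - A ⪰ 0`,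
  `D = ϑ' I - A' ⪰ 0`, `J` all-ones, is dual feasible for `G ⊠ H` (`isThetaDualFeasible_prodDual`:
  off the edges of the strong product one of the factors `1 + C_{ii'}`, `1 + D_{jj'}` of
  `(1 + C_{ii'})(1 + D_{jj'}) = 1 + [entry of J ⊗ D + C ⊗ J + C ⊗ D]` vanishes) and
  `ϑϑ' I - prodDual = J ⊗ₖ D + C ⊗ₖ J + C ⊗ₖ D ⪰ 0`; this is the dual-side counterpart (through
  the dictionary `a_{xy} = 1 - u_xᵀu_y/((cᵀu_x)(cᵀu_y))` of Lovász's proof of Theorem 3) of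
  Lovász's tensor product of optimal orthonormal representations with handles (1979, Lemmas 1–2)
  and of Knuth's Hadamard-product labelings (§20 (20.6)–(20.8)); weak duality
  `lovaszTheta_le_of_dual` finishes;
* `lovaszTheta_strongProd`, `lovaszTheta_strongCoprod` — **`ϑ(G ⊠ H) = ϑ(G ∗̄ H) = ϑ(G) ϑ(H)`**
  (Lovász 1979, Lemma 2 and Theorem 7; Knuth 1994, §20 Lemma (20.5) and §21 (21.3), unit
  weights), and
  Knuth's Corollary `lovaszTheta_eq_mul_of_between`: every `K` with `G ⊠ H ≤ K ≤ G ∗̄ H` has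
  `ϑ(K) = ϑ(G) ϑ(H)` (monotonicity);
* `indepNum_strongCoprod_le_mul`, `indepNum_strongProd_le_mul` — `α ≤ ϑ(G) ϑ(H)` for both
  products (Lovász's Lemma 3 `α ≤ ϑ` with Lemma 2: the step `k = 2` of Theorem 1);
* the pentagon: Shannon's independent set `{(i, 2i)}` (`shannonSet`, `isNIndepSet_shannonSet`),
  `lovaszTheta_cycleGraph_five_strongProd : ϑ(C₅ ⊠ C₅) = 5` (from the tree's `ϑ(C₅) = √5`) and
  `indepNum_cycleGraph_five_strongProd : α(C₅ ⊠ C₅) = 5` (Lovász 1979, §I and Theorem 2: the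
  case `k = 2` of `α(C₅^k) ≤ ϑ(C₅)^k = 5^{k/2}`).

Not here: the Shannon capacity `Θ(G) = sup_k α(G^{⊠k})^{1/k}` itself and `Θ(C₅) = √5`
(Lovász's Theorems 1–2 need the `k`-fold product), Knuth's weighted versions with factored
weights (20.4), and the orthonormal-representation (`ϑ₁`, `ϑ₄`) forms.

## References

* L. Lovász, *On the Shannon capacity of a graph*, IEEE Trans. Inform. Theory 25 (1979) 1–7,
  §I (strong product, `α(C₅²) = 5`), §II Lemmas 1–3 and Theorems 1–2, §III Theorems 3–4 and 7
  [Lovasz1979] (held: `lit read doi:10.1109/tit.1979.1055985`, pp. 1–2, 5).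
* D. E. Knuth, *The Sandwich Theorem*, Electron. J. Combin. 1 (1994), A1, §20 ((20.1)–(20.8),
  Lemma (20.5)), §21 ((21.1)–(21.3) and Corollary) [Knuth1994] (held: `lit read
  arxiv:math/9312214`, pp. 8–9).
-/

noncomputable section

namespace Literature.Combinatorics.SimpleGraph.LovaszThetaStrongProduct

open Matrix Finset Kronecker Literature.Combinatorics.SimpleGraph
open _root_.SimpleGraph (cycleGraph)

variable {V W : Type*}

/-! ### The strong product and Knuth's direct coproduct -/

/-- The **strong product** `G ⊠ H` on `V × W`: distinct pairs `(i, j)`, `(i', j')` are adjacent iff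
(`i = i'` or `i ∼ i'`) and (`j = j'` or `j ∼ j'`) (Lovász's `G · H`, Knuth's `G' ∗ G''`).
[cite: Knuth1994, §20 (20.1)–(20.3)] -/
def strongProd (G : SimpleGraph V) (H : SimpleGraph W) : SimpleGraph (V × W) where
  Adj x y := x ≠ y ∧ (x.1 = y.1 ∨ G.Adj x.1 y.1) ∧ (x.2 = y.2 ∨ H.Adj x.2 y.2)
  symm.symm _ _ h := ⟨h.1.symm, h.2.1.imp Eq.symm (fun h' => h'.symm),
    h.2.2.imp Eq.symm (fun h' => h'.symm)⟩
  loopless.irrefl _ h := h.1 rfl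

@[inherit_doc] scoped infixl:70 " ⊠ " => strongProd

/-- Knuth's **direct coproduct** `G ∗̄ H` on `V × W` (the disjunctive product): `(i, j) ∼ (i', j')`
iff `i ∼ i'` or `j ∼ j'`. [cite: Knuth1994, §21 (21.1)–(21.2)] -/
def strongCoprod (G : SimpleGraph V) (H : SimpleGraph W) : SimpleGraph (V × W) where
  Adj x y := G.Adj x.1 y.1 ∨ H.Adj x.2 y.2
  symm.symm _ _ h := h.imp (fun h' => h'.symm) (fun h' => h'.symm)
  loopless.irrefl _ h :=
    h.elim (fun h' => G.loopless.irrefl _ h') (fun h' => H.loopless.irrefl _ h')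

/-- Adjacency in the strong product (definitional unfolding). [cite: Knuth1994, §20 (20.3)] -/
@[simp] theorem strongProd_adj {G : SimpleGraph V} {H : SimpleGraph W} {x y : V × W} :
    (G ⊠ H).Adj x y ↔ x ≠ y ∧ (x.1 = y.1 ∨ G.Adj x.1 y.1) ∧ (x.2 = y.2 ∨ H.Adj x.2 y.2) :=
  Iff.rfl

/-- Adjacency in the direct coproduct (definitional unfolding). [cite: Knuth1994, §21 (21.2)] -/
@[simp] theorem strongCoprod_adj {G : SimpleGraph V} {H : SimpleGraph W} {x y : V × W} :
    (strongCoprod G H).Adj x y ↔ G.Adj x.1 y.1 ∨ H.Adj x.2 y.2 :=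
  Iff.rfl

/-- Adjacency in the strong product is decidable when it is in the factors. [folklore] -/
instance instDecidableRelStrongProdAdj [DecidableEq V] [DecidableEq W] (G : SimpleGraph V)
    (H : SimpleGraph W) [DecidableRel G.Adj] [DecidableRel H.Adj] : DecidableRel (G ⊠ H).Adj :=
  fun x y => inferInstanceAs
    (Decidable (x ≠ y ∧ (x.1 = y.1 ∨ G.Adj x.1 y.1) ∧ (x.2 = y.2 ∨ H.Adj x.2 y.2)))

/-- Adjacency in the direct coproduct is decidable when it is in the factors. [folklore] -/
instance instDecidableRelStrongCoprodAdj (G : SimpleGraph V) (H : SimpleGraph W)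
    [DecidableRel G.Adj] [DecidableRel H.Adj] : DecidableRel (strongCoprod G H).Adj :=
  fun x y => inferInstanceAs (Decidable (G.Adj x.1 y.1 ∨ H.Adj x.2 y.2))

/-- `G ⊠ H ≤ G ∗̄ H`: the coproduct is "richer" than the product (Knuth 1994, §21: "Indeed,
`G' ∗̄ G'' ⊇ G' ∗ G''` for all graphs"). [cite: Knuth1994, §21] -/
theorem strongProd_le_strongCoprod (G : SimpleGraph V) (H : SimpleGraph W) :
    G ⊠ H ≤ strongCoprod G H := by
  rintro ⟨i, j⟩ ⟨i', j'⟩ ⟨hne, h₁, h₂⟩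
  rcases h₁ with h₁ | h₁
  · rcases h₂ with h₂ | h₂
    · exact absurd (Prod.ext h₁ h₂) hne
    · exact Or.inr h₂
  · exact Or.inl h₁

/-- Knuth's definition (21.1) of the coproduct as a complement: `(Gᶜ ⊠ Hᶜ)ᶜ = G ∗̄ H`.
[cite: Knuth1994, §21 (21.1)] -/
theorem compl_strongProd_compl (G : SimpleGraph V) (H : SimpleGraph W) :
    (Gᶜ ⊠ Hᶜ)ᶜ = strongCoprod G H := by
  ext ⟨i, j⟩ ⟨i', j'⟩
  simp only [SimpleGraph.compl_adj, strongProd_adj, strongCoprod_adj, ne_eq, Prod.mk.injEq]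
  have h₁ : G.Adj i i' → ¬i = i' := fun h => G.ne_of_adj h
  have h₂ : H.Adj j j' → ¬j = j' := fun h => H.ne_of_adj h
  tauto

/-- `K_m ⊠ K_n = K_{mn}` (Knuth 1994, §20: "`K_{n'} ∗ K_{n''} = K_{n'n''}`").
[cite: Knuth1994, §20] -/
@[simp] theorem top_strongProd_top :
    (⊤ : SimpleGraph V) ⊠ (⊤ : SimpleGraph W) = ⊤ := by
  ext ⟨i, j⟩ ⟨i', j'⟩
  simp only [strongProd_adj, SimpleGraph.top_adj, ne_eq, Prod.mk.injEq]
  tauto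

/-- `K̄_m ⊠ K̄_n = K̄_{mn}` (Knuth 1994, §20). [cite: Knuth1994, §20] -/
@[simp] theorem bot_strongProd_bot :
    (⊥ : SimpleGraph V) ⊠ (⊥ : SimpleGraph W) = ⊥ := by
  ext ⟨i, j⟩ ⟨i', j'⟩
  simp only [strongProd_adj, SimpleGraph.bot_adj, ne_eq, Prod.mk.injEq, or_false]
  tauto

variable [Fintype V] [Fintype W]

/-! ### The lower bound: Kronecker products of feasible matrices -/

/-- The value of a Kronecker product: `𝟙ᵀ(B ⊗ C)𝟙 = (𝟙ᵀB𝟙)(𝟙ᵀC𝟙)`. [cite: Knuth1994, §20 (20.7)] -/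
theorem entrySum_kronecker (B : Matrix V V ℝ) (C : Matrix W W ℝ) :
    entrySum (B ⊗ₖ C) = entrySum B * entrySum C := by
  unfold entrySum
  rw [Fintype.sum_prod_type, Finset.sum_mul_sum]
  refine Finset.sum_congr rfl fun i _ => Finset.sum_congr rfl fun j _ => ?_
  rw [Fintype.sum_prod_type, Finset.sum_mul_sum]
  rfl

/-- **The Kronecker product of feasible matrices is feasible for the direct coproduct** (hence for
the strong product): `B ⊗ₖ C ⪰ 0`, `Tr(B ⊗ₖ C) = Tr B · Tr C = 1`, and on an edge
`(i, j)(i', j')` of `G ∗̄ H` one of `B_{ii'}`, `C_{jj'}` vanishes (Knuth's orthogonality check at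
the end of §20, "applied word-for-word" in §21). [cite: Knuth1994, §21 (21.3)] -/
theorem isThetaFeasible_kronecker_strongCoprod {G : SimpleGraph V} {H : SimpleGraph W}
    {B : Matrix V V ℝ} {C : Matrix W W ℝ} (hB : IsThetaFeasible G B) (hC : IsThetaFeasible H C) :
    IsThetaFeasible (strongCoprod G H) (B ⊗ₖ C) where
  posSemidef := hB.posSemidef.kronecker hC.posSemidef
  trace_eq_one := by rw [trace_kronecker, hB.trace_eq_one, hC.trace_eq_one, mul_one]
  apply_eq_zero := by
    rintro ⟨i, j⟩ ⟨i', j'⟩ (h | h)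
    · rw [kronecker_apply, hB.apply_eq_zero h, zero_mul]
    · rw [kronecker_apply, hC.apply_eq_zero h, mul_zero]

/-- The Kronecker product of feasible matrices is feasible for the strong product (the matrix
form — via Lovász's Theorem 4 — of the `≥` half of his Theorem 7, which Lovász proves with the
representations of Theorem 5; Knuth 1994, §20). [cite: Lovasz1979, Theorem 7] -/
theorem isThetaFeasible_kronecker {G : SimpleGraph V} {H : SimpleGraph W}
    {B : Matrix V V ℝ} {C : Matrix W W ℝ} (hB : IsThetaFeasible G B) (hC : IsThetaFeasible H C) :
    IsThetaFeasible (G ⊠ H) (B ⊗ₖ C) :=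
  (isThetaFeasible_kronecker_strongCoprod hB hC).anti (strongProd_le_strongCoprod G H)

/-- `𝟙ᵀB𝟙 = 𝟙 ⬝ (B 𝟙)`. [folklore] -/
@[folklore] private theorem entrySum_eq_one_dotProduct (B : Matrix V V ℝ) :
    entrySum B = (1 : V → ℝ) ⬝ᵥ (B *ᵥ 1) := by
  simp [entrySum, dotProduct, mulVec]

/-- A feasible matrix has nonnegative value `𝟙ᵀB𝟙 ≥ 0`. [folklore] -/
@[folklore] private theorem entrySum_nonneg {G : SimpleGraph V} {B : Matrix V V ℝ}
    (hB : IsThetaFeasible G B) : 0 ≤ entrySum B := by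
  rw [entrySum_eq_one_dotProduct]
  have := hB.posSemidef.dotProduct_mulVec_nonneg 1
  rwa [star_trivial] at this

/-- **`ϑ(G) ϑ(H) ≤ ϑ(G ∗̄ H)`** for the direct coproduct (Knuth 1994, §21 (21.3), unit weights,
the `≥` half): every product of feasible values `(𝟙ᵀB𝟙)(𝟙ᵀC𝟙)` is the value of the feasible
`B ⊗ₖ C`. [cite: Knuth1994, §21 (21.3)] -/
theorem mul_le_lovaszTheta_strongCoprod [DecidableEq V] [DecidableEq W] [Nonempty V] [Nonempty W]
    (G : SimpleGraph V) (H : SimpleGraph W) :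
    lovaszTheta G * lovaszTheta H ≤ lovaszTheta (strongCoprod G H) := by
  have hne₁ : (entrySum '' {B | IsThetaFeasible G B}).Nonempty :=
    ⟨_, _, isThetaFeasible_smul_one G, rfl⟩
  have hne₂ : (entrySum '' {C | IsThetaFeasible H C}).Nonempty :=
    ⟨_, _, isThetaFeasible_smul_one H, rfl⟩
  have hθ₂ : 0 < lovaszTheta H := zero_lt_one.trans_le (one_le_lovaszTheta H)
  have key : ∀ {B : Matrix V V ℝ} {C : Matrix W W ℝ}, IsThetaFeasible G B →
      IsThetaFeasible H C → entrySum B * entrySum C ≤ lovaszTheta (strongCoprod G H) := by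
    intro B C hB hC
    rw [← entrySum_kronecker]
    exact le_csSup (bddAbove_thetaValues _) ⟨_, isThetaFeasible_kronecker_strongCoprod hB hC, rfl⟩
  have step : ∀ {B : Matrix V V ℝ}, IsThetaFeasible G B →
      entrySum B * lovaszTheta H ≤ lovaszTheta (strongCoprod G H) := by
    intro B hB
    rcases (entrySum_nonneg hB).eq_or_lt with hp | hp
    · rw [← hp, zero_mul]; exact lovaszTheta_nonneg _
    · rw [← le_div_iff₀' hp]
      refine csSup_le hne₂ ?_
      rintro _ ⟨C, hC, rfl⟩
      rw [le_div_iff₀' hp]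
      exact key hB hC
  rw [← le_div_iff₀ hθ₂]
  refine csSup_le hne₁ ?_
  rintro _ ⟨B, hB, rfl⟩
  rw [le_div_iff₀ hθ₂]
  exact step hB

/-- **`ϑ(G) ϑ(H) ≤ ϑ(G ⊠ H)`** (Lovász 1979, Theorem 7, the `≥` half; Knuth 1994, §20 Lemma
(20.5), `≥`). [cite: Lovasz1979, Theorem 7] -/
theorem mul_le_lovaszTheta_strongProd [DecidableEq V] [DecidableEq W] [Nonempty V] [Nonempty W]
    (G : SimpleGraph V) (H : SimpleGraph W) :
    lovaszTheta G * lovaszTheta H ≤ lovaszTheta (G ⊠ H) :=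
  (mul_le_lovaszTheta_strongCoprod G H).trans (lovaszTheta_anti (strongProd_le_strongCoprod G H))

/-! ### The upper bound: a dual witness for the strong product -/

/-- The all-ones matrix `J = 𝟙𝟙ᵀ` is positive semidefinite. [folklore] -/
@[folklore] private theorem posSemidef_ones : (vecMulVec (1 : V → ℝ) 1).PosSemidef := by
  simpa using posSemidef_vecMulVec_self_star (1 : V → ℝ)

/-- **The dual witness for `G ⊠ H`** built from dual-feasible `A` (for `G`) and `A'` (for `H`)
with eigenvalue bounds `θ`, `θ'`:
`prodDual A A' θ θ' = θθ' I - (J ⊗ₖ D + C ⊗ₖ J + C ⊗ₖ D)`, `C = θ I - A`, `D = θ' I - A'`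
— the dual-side counterpart (under the dictionary `a_{xy} = 1 - u_xᵀu_y / ((cᵀu_x)(cᵀu_y))` of
Lovász's proof of Theorem 3, diagonal terms `1/(cᵀu_x)²` majorised by `θ`, `θ'`) of the tensor
product `u_i ⊗ v_j` with handle `c ⊗ d` of optimal orthonormal representations (Lovász 1979,
Lemmas 1–2; Knuth 1994, §20 (20.6)–(20.8)). [cite: Lovasz1979, Lemma 2] -/
def prodDual [DecidableEq V] [DecidableEq W] (A : Matrix V V ℝ) (A' : Matrix W W ℝ)
    (θ θ' : ℝ) : Matrix (V × W) (V × W) ℝ :=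
  (θ * θ') • (1 : Matrix (V × W) (V × W) ℝ) -
    (vecMulVec (1 : V → ℝ) 1 ⊗ₖ (θ' • (1 : Matrix W W ℝ) - A') +
      (θ • (1 : Matrix V V ℝ) - A) ⊗ₖ vecMulVec (1 : W → ℝ) 1 +
      (θ • (1 : Matrix V V ℝ) - A) ⊗ₖ (θ' • (1 : Matrix W W ℝ) - A'))

omit [Fintype V] [Fintype W] in
/-- The entries of `prodDual`: at `((i, j), (i', j'))` it is
`θθ'[i = i'][j = j'] - (D_{jj'} + C_{ii'} + C_{ii'} D_{jj'})` with `C_{ii'} = θ[i = i'] - A_{ii'}`,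
`D_{jj'} = θ'[j = j'] - A'_{jj'}`. [folklore] -/
@[folklore] private theorem prodDual_apply [DecidableEq V] [DecidableEq W] (A : Matrix V V ℝ)
    (A' : Matrix W W ℝ) (θ θ' : ℝ) (i i' : V) (j j' : W) :
    prodDual A A' θ θ' (i, j) (i', j') =
      θ * θ' * (if i = i' ∧ j = j' then 1 else 0) -
        ((θ' * (if j = j' then 1 else 0) - A' j j') + (θ * (if i = i' then 1 else 0) - A i i') +
          (θ * (if i = i' then 1 else 0) - A i i') *
            (θ' * (if j = j' then 1 else 0) - A' j j')) := by
  simp only [prodDual, Matrix.sub_apply, Matrix.add_apply, Matrix.smul_apply, kronecker_apply,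
    Matrix.one_apply, vecMulVec_apply, Pi.one_apply, Prod.mk.injEq, smul_eq_mul, mul_ite, mul_one,
    mul_zero, one_mul]

/-- **`prodDual` is dual feasible for the strong product**: it is symmetric, and at a non-adjacent
or diagonal pair `((i, j), (i', j'))` one has `A''_{(ij)(i'j')} = 1` — on the diagonal
`θθ' - ((θ' - 1) + (θ - 1) + (θ - 1)(θ' - 1)) = 1`; off the diagonal a non-edge of `G ⊠ H` has
`i ≠ i'`, `i ≁ i'` (so `C_{ii'} = -1`) or `j ≠ j'`, `j ≁ j'` (so `D_{jj'} = -1`), and then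
`D + C + CD = (1 + C)(1 + D) - 1 = -1`. [cite: Lovasz1979, Lemma 2] -/
theorem isThetaDualFeasible_prodDual [DecidableEq V] [DecidableEq W] {G : SimpleGraph V}
    {H : SimpleGraph W} {A : Matrix V V ℝ} {A' : Matrix W W ℝ} {θ θ' : ℝ}
    (hA : IsThetaDualFeasible G A) (hA' : IsThetaDualFeasible H A')
    (hC : (θ • (1 : Matrix V V ℝ) - A).PosSemidef) (hD : (θ' • (1 : Matrix W W ℝ) - A').PosSemidef)
    (hθ : 0 ≤ θ * θ') : IsThetaDualFeasible (G ⊠ H) (prodDual A A' θ θ') where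
  isHermitian := by
    unfold prodDual
    exact (PosSemidef.one.smul hθ).isHermitian.sub
      (((posSemidef_ones.kronecker hD).add (hC.kronecker posSemidef_ones)).add
        (hC.kronecker hD)).isHermitian
  apply_eq_one := by
    rintro ⟨i, j⟩ ⟨i', j'⟩ hxy
    rw [strongProd_adj] at hxy
    rw [prodDual_apply]
    by_cases hi : i = i'
    · subst hi
      by_cases hj : j = j'
      · subst hj
        rw [hA.apply_self, hA'.apply_self]
        simp only [and_self, if_true]
        ring
      · have hH : ¬H.Adj j j' := fun hH =>
          hxy ⟨fun h => hj (congrArg Prod.snd h), Or.inl rfl, Or.inr hH⟩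
        rw [hA.apply_self, hA'.apply_eq_one hH]
        simp only [hj, and_false, if_false, if_true]
        ring
    · by_cases hj : j = j'
      · subst hj
        have hG : ¬G.Adj i i' := fun hG =>
          hxy ⟨fun h => hi (congrArg Prod.fst h), Or.inr hG, Or.inl rfl⟩
        rw [hA.apply_eq_one hG, hA'.apply_self]
        simp only [hi, false_and, if_false, if_true]
        ring
      · simp only [hi, hj, false_and, if_false]
        by_cases hG : G.Adj i i'
        · have hH : ¬H.Adj j j' := fun hH =>
            hxy ⟨fun h => hi (congrArg Prod.fst h), Or.inr hG, Or.inr hH⟩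
          rw [hA'.apply_eq_one hH]; ring
        · rw [hA.apply_eq_one hG]; ring

/-- **`θθ' I - prodDual = J ⊗ₖ D + C ⊗ₖ J + C ⊗ₖ D ⪰ 0`**: Kronecker products and sums of
positive semidefinite matrices are positive semidefinite (`J = 𝟙𝟙ᵀ ⪰ 0`) — the Gram-matrix form
of Knuth's (20.7) `a_{(u',u'')} · a_{(v',v'')} = (a'_{u'} · a'_{v'})(a''_{u''} · a''_{v''})`.
[cite: Knuth1994, §20 (20.7)] -/
theorem posSemidef_smul_one_sub_prodDual [DecidableEq V] [DecidableEq W] {A : Matrix V V ℝ}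
    {A' : Matrix W W ℝ} {θ θ' : ℝ} (hC : (θ • (1 : Matrix V V ℝ) - A).PosSemidef)
    (hD : (θ' • (1 : Matrix W W ℝ) - A').PosSemidef) :
    ((θ * θ') • (1 : Matrix (V × W) (V × W) ℝ) - prodDual A A' θ θ').PosSemidef := by
  rw [prodDual, sub_sub_cancel]
  exact ((posSemidef_ones.kronecker hD).add (hC.kronecker posSemidef_ones)).add (hC.kronecker hD)

/-- **Lovász's Lemma 2: `ϑ(G ⊠ H) ≤ ϑ(G) ϑ(H)`** (1979, via tensor products of optimal
orthonormal representations; Knuth 1994, §20 Lemma (20.5), `≤`): take dual-feasible `A`, `A'`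
attaining `ϑ(G) I - A ⪰ 0`, `ϑ(H) I - A' ⪰ 0` (`exists_dual_of_lovaszTheta_eq`) and apply weak
duality to `prodDual A A' ϑ(G) ϑ(H)`. [cite: Lovasz1979, Lemma 2] -/
theorem lovaszTheta_strongProd_le_mul [DecidableEq V] [DecidableEq W] [Nonempty V] [Nonempty W]
    (G : SimpleGraph V) (H : SimpleGraph W) :
    lovaszTheta (G ⊠ H) ≤ lovaszTheta G * lovaszTheta H := by
  classical
  obtain ⟨A, hA, hC⟩ := exists_dual_of_lovaszTheta_eq G
  obtain ⟨A', hA', hD⟩ := exists_dual_of_lovaszTheta_eq H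
  have hθ : 0 ≤ lovaszTheta G * lovaszTheta H :=
    mul_nonneg (lovaszTheta_nonneg G) (lovaszTheta_nonneg H)
  exact lovaszTheta_le_of_dual (isThetaDualFeasible_prodDual hA hA' hC hD hθ)
    (posSemidef_smul_one_sub_prodDual hC hD) hθ

/-- `ϑ(G ∗̄ H) ≤ ϑ(G) ϑ(H)` (Knuth 1994, §21 (21.3), `≤`: the coproduct has more edges than the
product). [cite: Knuth1994, §21 (21.3)] -/
theorem lovaszTheta_strongCoprod_le_mul [DecidableEq V] [DecidableEq W] [Nonempty V] [Nonempty W]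
    (G : SimpleGraph V) (H : SimpleGraph W) :
    lovaszTheta (strongCoprod G H) ≤ lovaszTheta G * lovaszTheta H :=
  (lovaszTheta_anti (strongProd_le_strongCoprod G H)).trans (lovaszTheta_strongProd_le_mul G H)

/-! ### Lovász's Theorem 7 and Knuth's sandwich corollary -/

/-- **Lovász's Theorem 7: `ϑ(G ⊠ H) = ϑ(G) ϑ(H)`** for the strong product of graphs on nonempty
finite vertex types (Knuth 1994, §20 Lemma (20.5) with unit weights).
[cite: Lovasz1979, Theorem 7] -/
theorem lovaszTheta_strongProd [DecidableEq V] [DecidableEq W] [Nonempty V] [Nonempty W]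
    (G : SimpleGraph V) (H : SimpleGraph W) :
    lovaszTheta (G ⊠ H) = lovaszTheta G * lovaszTheta H :=
  le_antisymm (lovaszTheta_strongProd_le_mul G H) (mul_le_lovaszTheta_strongProd G H)

/-- **Knuth's (21.3): `ϑ(G ∗̄ H) = ϑ(G) ϑ(H)`** for the direct coproduct, unit weights.
[cite: Knuth1994, §21 (21.3)] -/
theorem lovaszTheta_strongCoprod [DecidableEq V] [DecidableEq W] [Nonempty V] [Nonempty W]
    (G : SimpleGraph V) (H : SimpleGraph W) :
    lovaszTheta (strongCoprod G H) = lovaszTheta G * lovaszTheta H :=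
  le_antisymm (lovaszTheta_strongCoprod_le_mul G H) (mul_le_lovaszTheta_strongCoprod G H)

/-- **Knuth's Corollary (§21): "many graphs have identical `ϑ`'s"** — if
`G ⊠ H ≤ K ≤ G ∗̄ H` then `ϑ(K) = ϑ(G) ϑ(H)` ("this is just the monotonicity relation (4.3)").
[cite: Knuth1994, §21 Corollary] -/
theorem lovaszTheta_eq_mul_of_between [DecidableEq V] [DecidableEq W] [Nonempty V] [Nonempty W]
    {G : SimpleGraph V} {H : SimpleGraph W} {K : SimpleGraph (V × W)} (h₁ : G ⊠ H ≤ K)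
    (h₂ : K ≤ strongCoprod G H) : lovaszTheta K = lovaszTheta G * lovaszTheta H :=
  le_antisymm ((lovaszTheta_anti h₁).trans (lovaszTheta_strongProd_le_mul G H))
    ((mul_le_lovaszTheta_strongCoprod G H).trans (lovaszTheta_anti h₂))

/-! ### Independent sets in products -/

/-- **`α(G ∗̄ H) ≤ ϑ(G) ϑ(H)`**: the sandwich bound `α ≤ ϑ` (`le_lovaszTheta_compl_of_isNClique`
applied to a maximum independent set, a clique of the complement — Lovász's Lemma 3) and (21.3).
[cite: Lovasz1979, Lemma 3] -/
theorem indepNum_strongCoprod_le_mul [DecidableEq V] [DecidableEq W] [Nonempty V] [Nonempty W]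
    (G : SimpleGraph V) (H : SimpleGraph W) :
    ((strongCoprod G H).indepNum : ℝ) ≤ lovaszTheta G * lovaszTheta H := by
  obtain ⟨S, hS⟩ := (strongCoprod G H).exists_isNIndepSet_indepNum
  have h := le_lovaszTheta_compl_of_isNClique ((SimpleGraph.isNClique_compl _).2 hS)
  rw [compl_compl] at h
  exact h.trans (lovaszTheta_strongCoprod_le_mul G H)

/-- **`α(G ⊠ H) ≤ ϑ(G) ϑ(H)`** — the case `k = 2` of `α(G^k) ≤ ϑ(G^k) ≤ ϑ(G)^k` ("by Lemmas
1 and 2") in Lovász's proof of Theorem 1 (`Θ(G) ≤ ϑ(G)`). [cite: Lovasz1979, Theorem 1] -/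
theorem indepNum_strongProd_le_mul [DecidableEq V] [DecidableEq W] [Nonempty V] [Nonempty W]
    (G : SimpleGraph V) (H : SimpleGraph W) :
    ((G ⊠ H).indepNum : ℝ) ≤ lovaszTheta G * lovaszTheta H := by
  obtain ⟨S, hS⟩ := (G ⊠ H).exists_isNIndepSet_indepNum
  have h := le_lovaszTheta_compl_of_isNClique ((SimpleGraph.isNClique_compl _).2 hS)
  rw [compl_compl] at h
  exact h.trans (lovaszTheta_strongProd_le_mul G H)

/-! ### The pentagon: `ϑ(C₅ ⊠ C₅) = α(C₅ ⊠ C₅) = 5` -/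

/-- **`ϑ(C₅ ⊠ C₅) = ϑ(C₅)² = 5`** (Lovász 1979: `ϑ(C₅) = √5`, in the tree as
`lovaszTheta_cycleGraph_five`, with Theorem 7). [cite: Lovasz1979, Theorems 2 and 7] -/
theorem lovaszTheta_cycleGraph_five_strongProd :
    lovaszTheta (cycleGraph 5 ⊠ cycleGraph 5) = 5 := by
  rw [lovaszTheta_strongProd, Optimization.DeKlerkPasechnikLovaszTheta.lovaszTheta_cycleGraph_five,
    Real.mul_self_sqrt (by norm_num)]

/-- **Shannon's independent set in `C₅ ⊠ C₅`**: the five pairs `(i, 2i mod 5)` — Lovász's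
"words `v₁v₁, v₂v₃, v₃v₅, v₄v₂, v₅v₄`" with `vₖ ↦ k - 1`. [cite: Lovasz1979, §I] -/
def shannonSet : Finset (Fin 5 × Fin 5) := {(0, 0), (1, 2), (2, 4), (3, 1), (4, 3)}

/-- `{(i, 2i)}` is an independent `5`-set of `C₅ ⊠ C₅` (Lovász 1979, §I: "the words
`v₁v₁, v₂v₃, v₃v₅, v₄v₂, v₅v₄` are nonconfoundable"). [cite: Lovasz1979, §I] -/
theorem isNIndepSet_shannonSet : (cycleGraph 5 ⊠ cycleGraph 5).IsNIndepSet 5 shannonSet := by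
  decide

/-- **`α(C₅ ⊠ C₅) = 5`** (Lovász 1979, §I: "if `C₅` is a pentagon, then `α(C₅²) = 5`"; here the
upper bound is `α(C₅ ⊠ C₅) ≤ ϑ(C₅)² = 5`, the case `k = 2` of Theorem 2's `α(C₅^k) ≤ 5^{k/2}`).
[cite: Lovasz1979, §I and Theorem 2] -/
theorem indepNum_cycleGraph_five_strongProd : (cycleGraph 5 ⊠ cycleGraph 5).indepNum = 5 := by
  refine le_antisymm ?_ ?_
  · have h := indepNum_strongProd_le_mul (cycleGraph 5) (cycleGraph 5)
    rw [← lovaszTheta_strongProd, lovaszTheta_cycleGraph_five_strongProd] at h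
    exact_mod_cast h
  · have h := isNIndepSet_shannonSet.isIndepSet.card_le_indepNum
    rwa [isNIndepSet_shannonSet.card_eq] at h

end Literature.Combinatorics.SimpleGraph.LovaszThetaStrongProduct
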